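/-
Copyright (c) 2026 the pub-hodgecm-mathlib formalisation cell (harness21).  Prover seat hodgecm-mathlib-K2Liu-p08 (g4), Track B «K2-LIT» ∕ hLiu418
#184♮, socket #42S organ S1 (ROAD W), brick F8 (hDW-alg)-split (LEAD F0P6-plan (g14) BATCH #16 «p08: F8-split socket»; K2Liu-p01 (g8) SPEC-F7-PhaseChain
e96aa88172f3bbd5 §2 (dual) «the split twin reads the same with ★ p08's all-Y duality»).  2026-09-04.  KERNEL: theorems only.
-/
import Summits.HodgeConjecture.HodgeConjecture.Theorems.K2LiuLocalRingSplitReading     -- ★ p860045: the reading, `reading_surjective`, `forall_valued_le_iff`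
import Summits.HodgeConjecture.HodgeConjecture.Theorems.K2LiuTraceDualityMatrixBox      -- ★ p860061: `forall_valuation_trace_mul_le_iff`, `valuation_trace_mul_le`
import Mathlib.LinearAlgebra.Matrix.Trace
import HarnessLib

/-!
# Crux `HLiu418`, #42S-S1 ROAD W, brick F8 (hDW-alg)-split: THE HERMITIAN TRACE DUALITY AT A SPLIT PLACE — `∀ H ∈ Herm₂(𝒪), tr(H·G) ∈ 𝔭^m  ↔  G(w₀) ∈ 𝔭^m`

Cell `hodgecm-mathlib`, crux item hLiu418 = `stmt-HodgeConjecture-24832` (helper lane `--supports … --as helper`, count-neutral).  THEOREMS ONLY (no `def`, no instance,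
no notation, no named-fact hypothesis, no `sorry`).  The SPLIT twin of K2Liu-p01 (g8)'s (hDW-alg) `K2LiuHermitianTraceDualityLetter` (SPEC-F7-PhaseChain §2 (dual)):
at a place `v` split in `E∕F` the test matrices `H ∈ Herm₂(𝒪_E ⊗ 𝒪_v)` read at `w₀` as ALL of `M₂(𝒪_{w₀})` (a hermitian `H` has a free `w₀`-component, ★ reading p860045),
`tr(H·G)` is `σ`-fixed for hermitian `H, G` (so its two readings coincide), and `tr(H·G)(w₀) = tr(H′·G′)`; hence the full-box self-duality ★ p860061 gives
* `map_conjLocal_eq_transpose_of_herm`, `conjLocal_trace_mul_of_herm` (`σ tr(HG) = tr(HG)`), `trace_mul_apply_eq` (`tr(HG)(w₀) = tr(H(w₀)·G(w₀))`),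
  `exists_herm_of_reading` (every integral `Y ∈ M₂(E_{w₀})` is `H(w₀)` for an integral hermitian `H`), and ★★ HEAD
  **`forall_herm_trace_le_iff`**: `(∀ H hermitian, (∀ i j w, v(H i j w) ≤ 1) → ∀ w, v(tr(H·G) w) ≤ r) ↔ ∀ i j, v(G i j w₀) ≤ r` — with ★ `reading_gram_fst` (`G i j w₀ = K i j`,
  `K = A′B″ᵀ + B′A″ᵀ + d′C′C″ᵀ`) this is the Gram conjunct of ★ (iii-b)-split `image_witnessCells_eq`, i.e. the split `hDW` letter of ★ (J) ∕ (J)-split p860282.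
[CasselsFrohlichANT1967, Ch. II §10] [Shimura1997, §13.2] [Weil1964, §20].
HONEST LABEL.  Count-neutral helper; `HC_CM` is proved only modulo the 7 printed citations (2 remaining named inputs: hLiu418 = `stmt-HodgeConjecture-24832`,
h413 = `stmt-HodgeConjecture-24833`) until rung 0 closes.

## References
* [CasselsFrohlichANT1967] J. W. S. Cassels, A. Fröhlich (eds.), *Algebraic Number Theory* (1967), Ch. II §10.   * [Shimura1997] G. Shimura, CBMS 93 (1997), §13.2.
* [Weil1964] A. Weil, Acta Math. 111 (1964), §20.
-/

set_option autoImplicit false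
set_option linter.dupNamespace false -- the mandated namespace repeats `HodgeConjecture.HodgeConjecture`

open Matrix
open Literature.NumberTheory.Automorphic Literature.NumberTheory.Automorphic.UnitaryGroup

namespace Summit.HodgeConjecture.HodgeConjecture.Cruxes.HLiu418.K2LiuSplitHermitianTraceDuality

open K2LiuLocalRingSplitReading K2LiuTraceDualityMatrixBox

variable {F E : Type} [Field F] [NumberField F] [Field E] [NumberField E] [Algebra F E] [Algebra.IsQuadraticExtension F E]
  (c : E ≃ₐ[F] E) {δ : E} (hcδ : c δ = -δ) (hδ : δ ≠ 0) (v : IsDedekindDomain.HeightOneSpectrum (NumberField.RingOfIntegers F))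
  (w₀ : PlacesOver E v) (hw₀ : c • w₀.1 ≠ w₀.1)

omit [Algebra.IsQuadraticExtension F E] in
/-- a hermitian matrix maps under `σ` to its transpose. [folklore] -/
theorem map_conjLocal_eq_transpose_of_herm {n : Type*} {H : Matrix n n (LocalRing E v)} (hH : ∀ i j, conjLocal E c v (H i j) = H j i) :
    H.map (conjLocal E c v) = Hᵀ :=
  Matrix.ext fun i j => hH i j

omit [Algebra.IsQuadraticExtension F E] in
/-- `σ tr(H·G) = tr(H·G)` for hermitian `H, G`. [cite: Shimura1997, §13.2] -/
theorem conjLocal_trace_mul_of_herm {n : Type*} [Fintype n] {H G : Matrix n n (LocalRing E v)} (hH : ∀ i j, conjLocal E c v (H i j) = H j i)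
    (hG : ∀ i j, conjLocal E c v (G i j) = G j i) : conjLocal E c v (trace (H * G)) = trace (H * G) := by
  rw [AddMonoidHom.map_trace (conjLocal E c v : LocalRing E v →+* LocalRing E v) (H * G)]
  rw [Matrix.map_mul, map_conjLocal_eq_transpose_of_herm c v hH, map_conjLocal_eq_transpose_of_herm c v hG, ← transpose_mul, trace_transpose, trace_mul_comm]

omit [NumberField F] [Algebra.IsQuadraticExtension F E] in
/-- `tr(H·G)(w₀) = tr(H(w₀)·G(w₀))` (evaluation is a ring homomorphism). [folklore] -/
theorem trace_mul_apply_eq {n : Type*} [Fintype n] (H G : Matrix n n (LocalRing E v)) :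
    trace (H * G) w₀ = trace (H.map (fun z : LocalRing E v => z w₀) * G.map (fun z : LocalRing E v => z w₀)) := by
  have h := AddMonoidHom.map_trace (Pi.evalRingHom (fun w : PlacesOver E v => w.1.adicCompletion E) w₀) (H * G)
  rw [Matrix.map_mul] at h
  exact h

include hcδ hδ hw₀ in
/-- **EVERY INTEGRAL `Y ∈ M₂(E_{w₀})` IS THE `w₀`-READING OF AN INTEGRAL HERMITIAN `H`** (`H i j := ρ⁻¹(Y i j, Y j i)`). [cite: CasselsFrohlichANT1967, Ch. II §10] -/
theorem exists_herm_of_reading {n : Type*} (Y : Matrix n n ((w₀.1).adicCompletion E)) (hY : ∀ i j, Valued.v (Y i j) ≤ 1) :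
    ∃ H : Matrix n n (LocalRing E v), (∀ i j, conjLocal E c v (H i j) = H j i) ∧ (∀ i j (w : PlacesOver E v), Valued.v (H i j w) ≤ 1) ∧
      H.map (fun z : LocalRing E v => z w₀) = Y := by
  classical
  have hex : ∀ i j, ∃ z : LocalRing E v, z w₀ = Y i j ∧ conjLocal E c v z w₀ = Y j i := by
    intro i j
    obtain ⟨z, hz⟩ := reading_surjective c hcδ hδ v w₀ hw₀ (Y i j, Y j i)
    exact ⟨z, congrArg Prod.fst hz, congrArg Prod.snd hz⟩
  choose Hf hHf using hex
  refine ⟨of Hf, fun i j => ?_, fun i j => ?_, ?_⟩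
  · -- hermitian: both readings of `σ (H i j)` and `H j i` agree
    refine reading_injective c v w₀ hw₀ (Prod.ext ?_ ?_)
    · show conjLocal E c v (Hf i j) w₀ = Hf j i w₀
      rw [(hHf i j).2, (hHf j i).1]
    · show conjLocal E c v (conjLocal E c v (Hf i j)) w₀ = conjLocal E c v (Hf j i) w₀
      rw [conjLocal_conjLocal c v hcδ hδ, (hHf i j).1, (hHf j i).2]
  · rw [forall_valued_le_iff c v w₀ hw₀]
    refine ⟨?_, ?_⟩
    · show Valued.v (Hf i j w₀) ≤ 1
      rw [(hHf i j).1]; exact hY i j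
    · show Valued.v (conjLocal E c v (Hf i j) w₀) ≤ 1
      rw [(hHf i j).2]; exact hY j i
  · exact Matrix.ext fun i j => (hHf i j).1

include hcδ hδ hw₀ in
/-- **THE HERMITIAN TRACE DUALITY AT A SPLIT PLACE** (HEAD): for a hermitian `G` over `E ⊗ F_v` and any bound `r`,
`(∀ H hermitian with integral entries, ∀ w ∣ v, v_w(tr(H·G)(w)) ≤ r) ↔ ∀ i j, v(G i j (w₀)) ≤ r`. [cite: Weil1964, §20] [cite: Shimura1997, §13.2] -/
theorem forall_herm_trace_le_iff {n : Type*} [Fintype n] [DecidableEq n] {G : Matrix n n (LocalRing E v)} (hG : ∀ i j, conjLocal E c v (G i j) = G j i)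
    (r : WithZero (Multiplicative ℤ)) :
    (∀ H : Matrix n n (LocalRing E v), (∀ i j, conjLocal E c v (H i j) = H j i) → (∀ i j (w : PlacesOver E v), Valued.v (H i j w) ≤ 1) →
        ∀ w : PlacesOver E v, Valued.v (trace (H * G) w) ≤ r) ↔
      ∀ i j, Valued.v (G i j w₀) ≤ r := by
  have hc : c ≠ 1 := fun h => hw₀ (by rw [h, one_smul])
  constructor
  · intro h
    -- the full-box duality over the field `E_{w₀}` for `G(w₀)`
    refine (forall_valuation_trace_mul_le_iff (Valued.v) (G.map (fun z : LocalRing E v => z w₀)) r).1 fun Y hY => ?_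
    obtain ⟨H, hH, hHint, hHY⟩ := exists_herm_of_reading c hcδ hδ v w₀ hw₀ Y hY
    have := h H hH hHint w₀
    rw [trace_mul_apply_eq, hHY] at this
    exact this
  · intro h H hH hHint w
    -- at `w₀` directly; at `w̄₀` through `σ tr(HG) = tr(HG)`
    have hw₀case : Valued.v (trace (H * G) w₀) ≤ r := by
      rw [trace_mul_apply_eq]
      exact valuation_trace_mul_le (Valued.v) (fun a b => hHint a b w₀) (fun i j => h i j)
    rcases PlacesOver.eq_or_eq_galInv c hc w₀ w with rfl | rfl
    · exact hw₀case
    · rw [← valued_reading_snd c v w₀ (trace (H * G)), reading_snd]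
      show Valued.v (conjLocal E c v (trace (H * G)) w₀) ≤ r
      rw [conjLocal_trace_mul_of_herm c v hH hG]
      exact hw₀case

end Summit.HodgeConjecture.HodgeConjecture.Cruxes.HLiu418.K2LiuSplitHermitianTraceDuality
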